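import Literature.Analysis.FluidPDE.WholeSpaceIBPIntegrable
import Literature.Analysis.FluidPDE.AncientSimilarityVorticity
import HarnessLib

/-!
# Route CorkscrewDynamo · crux `CorkscrewProfile` (stmt-NavierStokesRegularity-11282) — tool stub W1: Gaussian integration by parts for a divergence

Tool stub `stub_gaussianDivergenceIBP` of line `registered` (skeleton v14, lead c6, wave 2): the
generic GAUSSIAN INTEGRATION BY PARTS behind the Gaussian angular-momentum identity of a rotated
Leray profile. On a finite-dimensional real inner product space `E` with the Gaussian weight
`G(y) = e^{−‖y‖²/4}` of the backward similarity variables (`∇G = −½ G y`), for a `C¹` vector field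
`F : E → E` with `G • F`, `G div F` and `G ⟪y, F⟫` integrable,

  `∫ G div F = ½ ∫ G ⟪y, F⟫`

— no decay of `F` at infinity is needed beyond these `L¹` hypotheses (the weight does the work).

Proof: the tree's `L¹` integration by parts on the whole space
`∫ θ div u + ∫ ⟪u, ∇θ⟫ = 0` (`integral_mul_divergence_add_eq_zero_of_integrable`,
`WholeSpaceIBPIntegrable.lean`, from `∫ div (θ u) = 0` for `θ u`, `div (θ u)` in `L¹`) with `θ = G`,
`u = F`, and the gradient of the weight, `⟪F y, ∇G(y)⟫ = DG(y)[F y] = −½ G(y) ⟪y, F y⟫`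
(`fderiv_gaussianWeightFun_apply`, `AncientSimilarityVorticity.lean`).
-/

noncomputable section

open MeasureTheory InnerProductSpace
open Literature.Analysis.FluidPDE
open scoped RealInnerProductSpace

namespace Summit.NavierStokesRegularity.NavierStokesRegularity.Theorems.CorkscrewProfile.Birth

set_option linter.dupNamespace false

variable {E : Type*} [NormedAddCommGroup E] [InnerProductSpace ℝ E] [FiniteDimensional ℝ E]

/-- **The gradient of the Gaussian weight, paired**: `⟪v, ∇G(y)⟫ = −½ G(y) ⟪y, v⟫` for
`G(y) = e^{−‖y‖²/4}` (`∇G = −½ G y`; `⟪v, ∇G(y)⟫ = DG(y)[v]` and `fderiv_gaussianWeightFun_apply`). [folklore] -/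
theorem inner_gradient_gaussianWeightFun (y v : E) :
    ⟪v, gradient (fun x : E => Real.exp (-‖x‖ ^ 2 / 4)) y⟫ =
      -(1 / 2 : ℝ) * (Real.exp (-‖y‖ ^ 2 / 4) * ⟪y, v⟫) := by
  rw [real_inner_comm, gradient, InnerProductSpace.toDual_symm_apply, fderiv_gaussianWeightFun_apply]
  ring

/-- **Tool stub W1 — Gaussian integration by parts for a divergence.** For a `C¹` field `F` on a
finite-dimensional real inner product space with `G • F`, `G div F` and `G ⟪y, F⟫` integrable
(`G(y) = e^{−‖y‖²/4}`, `∇G = −½ G y`): `∫ G div F = ½ ∫ G ⟪y, F⟫`. Indeed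
`∫ G div F + ∫ ⟪F, ∇G⟫ = 0` (whole-space integration by parts in `L¹` form,
`integral_mul_divergence_add_eq_zero_of_integrable`: `div (G F) = G div F + ⟪F, ∇G⟫` and
`∫ div (G F) = 0`) and `⟪F, ∇G⟫ = −½ G ⟪y, F⟫` (Evans, *PDE*, App. C.2, Thm. 2, with the
Gaussian weight of the similarity variables; Gallay–Wayne 2005 §4.1.3 for the forward twin). [folklore] -/
theorem stub_gaussianDivergenceIBP [MeasurableSpace E] [BorelSpace E] {F : E → E} (hF : ContDiff ℝ 1 F)
    (hGF : MeasureTheory.Integrable (fun y => Real.exp (-‖y‖ ^ 2 / 4) • F y))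
    (hGdiv : MeasureTheory.Integrable (fun y => Real.exp (-‖y‖ ^ 2 / 4) * VectorCalculus.divergence F y))
    (hGyF : MeasureTheory.Integrable (fun y => Real.exp (-‖y‖ ^ 2 / 4) * ⟪y, F y⟫)) :
    ∫ y, Real.exp (-‖y‖ ^ 2 / 4) * VectorCalculus.divergence F y =
      (1 / 2 : ℝ) * ∫ y, Real.exp (-‖y‖ ^ 2 / 4) * ⟪y, F y⟫ := by
  -- the pairing with the gradient of the weight
  have hgrad : ∀ y, ⟪F y, gradient (fun x : E => Real.exp (-‖x‖ ^ 2 / 4)) y⟫ =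
      -(1 / 2 : ℝ) * (Real.exp (-‖y‖ ^ 2 / 4) * ⟪y, F y⟫) := fun y =>
    inner_gradient_gaussianWeightFun y (F y)
  have h₂ : Integrable fun y => ⟪F y, gradient (fun x : E => Real.exp (-‖x‖ ^ 2 / 4)) y⟫ := by
    simp_rw [hgrad]
    exact hGyF.const_mul _
  -- whole-space integration by parts in `L¹` form with `θ = G`, `u = F`
  have key := integral_mul_divergence_add_eq_zero_of_integrable
    (θ := fun x : E => Real.exp (-‖x‖ ^ 2 / 4)) contDiff_gaussianWeightFun hF hGF hGdiv h₂
  simp_rw [hgrad] at key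
  rw [integral_const_mul] at key
  linarith

end Summit.NavierStokesRegularity.NavierStokesRegularity.Theorems.CorkscrewProfile.Birth

end
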